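import Summits.PneNP.PneNP.Theorems.NegLimitedAmplifiedWindowAmpHybrid
import Summits.PneNP.PneNP.Theorems.NegLimitedAmplifiedWindowAmpCircuits
import Mathlib
import HarnessLib

/-!
# Amplified critical window — stub A, assembly core (from a balanced hard-core piece to the agreement bound)
(cell pnp-ideate, rung F-N1/p3, ROUND-12; line `amplified-window` on item stmt-PneNP-19860, stub A
`MonotoneAmplification`; blueprint HOME/pnp-ideate-p3/r12/BLUEPRINT-A.md §9)

`core_bound`: given the balanced trimmed hard-core measure `H'` (from A1 + A2: `D·H'` has mass `p/2` on
each side of `f`, and every `{∧,∨,0,1}`-circuit of size `≤ |M| + 2` has signed advantage `≤ 4γp` on it), the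
agreement of the monotone circuit `M` with `RM3_d ⊗ f` under `D^{⊗3^d}` is at most
`½ + ½·expAbsBias d p + 2γ·3^d`.  Chain: A3' (curry) → A3 (mixture over the set `S` of hard blocks) →
per `S`: A0 + the hypothesis give the one-block bound `(½ + 2γ)·p`, A4 (`Amp.hybridStep`, `η = 2γ`),
A5 (coins), A6 (pushforward; the bit masses are exactly `p/2` and `(1−p)/2`) → binomial resummation
(`Fintype.sum_pow_mul_eq_add_pow`).

References: R. O'Donnell, JCSS 69 (2004), §3–4; A. Healy, S. Vadhan, E. Viola, SICOMP 35 (2006), §3.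

HONEST FRAMING: a sub-lemma of the OPEN stub A; nothing here bears on P vs NP.
-/

set_option linter.dupNamespace false -- `Summit.PneNP.PneNP.…`: summit = sub-problem name (D-0017 single-conjunct layout)

namespace Summit.PneNP.PneNP.Theorems.NegLimitedAmplifiedWindow.Amp

open Finset Function
open Literature.Computability.Complexity
open Summit.PneNP.PneNP.Theorems.NegLimitedDoor (massAt agreeAt massAt_false_add_massAt_true)
open Summit.PneNP.PneNP.Theorems.NegLimitedAmplifiedWindow (recMaj3 recMaj3_monotone ampFn prodWeight)

/-! ### Small identities -/

/-- Agreement mass through the signed advantage: `Σ_a [g a = f a]·μ a = (Σ μ + Σ μ·sgn)/2`. -/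
theorem sum_ite_agree_eq {𝒳 : Type} [Fintype 𝒳] (μ : 𝒳 → ℝ) (g f : 𝒳 → Bool) :
    ∑ a, (if g a = f a then μ a else 0) =
      (∑ a, μ a + ∑ a, μ a * (if g a = f a then (1 : ℝ) else -1)) / 2 := by
  rw [← Finset.sum_add_distrib, Finset.sum_div]
  exact Finset.sum_congr rfl fun a _ => by split_ifs <;> ring

/-- `massAt` is additive in the weight (complement form). -/
theorem massAt_mul_one_sub {𝒳 : Type} [Fintype 𝒳] (D H : 𝒳 → ℝ) (f : 𝒳 → Bool) (b : Bool) :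
    massAt (fun a => D a * (1 - H a)) f b = massAt D f b - massAt (fun a => D a * H a) f b := by
  unfold massAt
  rw [← Finset.sum_sub_distrib]
  exact Finset.sum_congr rfl fun a _ => by split_ifs <;> ring

/-- Products of a two-valued function of membership. -/
theorem prod_ite_mem_eq_pow {W : Type} [Fintype W] [DecidableEq W] (S : Finset W) (a b : ℝ) :
    ∏ w, (if w ∈ S then a else b) = a ^ S.card * b ^ (Fintype.card W - S.card) := by
  rw [Finset.prod_ite, Finset.prod_const, Finset.prod_const, Finset.filter_univ_mem]
  congr 2
  have h := Finset.card_filter_add_card_filter_not (s := (univ : Finset W)) (fun w => w ∈ S)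
  rw [Finset.filter_univ_mem, Finset.card_univ] at h
  omega

/-! ### The core bound -/

/-- **Assembly core.**  See the module docstring. -/
theorem core_bound {ι : Type} [Fintype ι] [DecidableEq ι] (D H' : (ι → Bool) → ℝ) (f : (ι → Bool) → Bool)
    (d : ℕ) (M : Circuit ((Fin d → Fin 3) × ι)) (hM : M.IsOver monotoneBasis01) {p γ : ℝ}
    (hD : ∀ x, 0 ≤ D x) (hD1 : ∑ x, D x = 1) (hbal : massAt D f true = 1 / 2)
    (hH0 : ∀ x, 0 ≤ H' x) (hH1 : ∀ x, H' x ≤ 1) (hγ : 0 ≤ γ) (hp1 : p ≤ 1)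
    (hmt : massAt (fun x => D x * H' x) f true = p / 2) (hmf : massAt (fun x => D x * H' x) f false = p / 2)
    (hadv : ∀ C : Circuit ι, C.IsOver monotoneBasis01 → C.size ≤ M.size + 2 →
      ∑ x, D x * H' x * (if C.eval x = f x then (1 : ℝ) else -1) ≤ 4 * γ * p) :
    agreeAt (prodWeight d D) (ampFn d f) M.eval ≤ 1 / 2 + (1 / 2) * expAbsBias d p + 2 * γ * (3 : ℝ) ^ d := by
  classical
  -- notation
  have hN : Fintype.card (Fin d → Fin 3) = 3 ^ d := by simp
  set μ₁ : (ι → Bool) → ℝ := fun a => D a * H' a with hμ₁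
  set μ₂ : (ι → Bool) → ℝ := fun a => D a * (1 - H' a) with hμ₂
  set g : ((Fin d → Fin 3) → ι → Bool) → Bool := fun X => M.eval fun q => X q.1 q.2 with hg
  have hμ₁0 : ∀ a, 0 ≤ μ₁ a := fun a => mul_nonneg (hD a) (hH0 a)
  have hμ₂0 : ∀ a, 0 ≤ μ₂ a := fun a => mul_nonneg (hD a) (by linarith [hH1 a])
  -- masses
  have hbalf : massAt D f false = 1 / 2 := by
    have := massAt_false_add_massAt_true D f; rw [hbal, hD1] at this; linarith
  have hm₁ : ∑ a, μ₁ a = p := by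
    have := massAt_false_add_massAt_true μ₁ f; rw [hmt, hmf] at this; linarith
  have hp0 : 0 ≤ p := by rw [← hm₁]; exact Finset.sum_nonneg fun a _ => hμ₁0 a
  have hm₂ : ∑ a, μ₂ a = 1 - p := by
    have : ∑ a, μ₂ a = ∑ a, D a - ∑ a, μ₁ a := by
      rw [← Finset.sum_sub_distrib]; exact Finset.sum_congr rfl fun a _ => by simp only [hμ₁, hμ₂]; ring
    rw [this, hD1, hm₁]
  have hmass₁ : ∀ b, massAt μ₁ f b = p / 2 := fun b => by cases b <;> assumption
  have hmass₂ : ∀ b, massAt μ₂ f b = (1 - p) / 2 := fun b => by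
    rw [hμ₂, massAt_mul_one_sub]
    cases b
    · rw [hbalf, hmf]; ring
    · rw [hbal, hmt]; ring
  -- A3' + A3
  rw [curryBridge_holds ι d D f M.eval]
  have hDμ : (fun _ : Fin d → Fin 3 => D) = fun _ => μ₁ + μ₂ := by
    funext w; funext a; simp only [Pi.add_apply, hμ₁, hμ₂]; ring
  rw [hDμ, mixtureExpansion_holds (Fin d → Fin 3) (ι → Bool) μ₁ μ₂]
  -- the weight with hard set `S`
  set μS : Finset (Fin d → Fin 3) → (Fin d → Fin 3) → (ι → Bool) → ℝ :=
    fun S w => if w ∈ S then μ₁ else μ₂ with hμS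
  have hμS0 : ∀ S w a, 0 ≤ μS S w a := fun S w a => by
    simp only [hμS]; split_ifs; exacts [hμ₁0 a, hμ₂0 a]
  have hsumS : ∀ S w, ∑ a, μS S w a = if w ∈ S then p else 1 - p := fun S w => by
    simp only [hμS]; split_ifs; exacts [hm₁, hm₂]
  have hmassS : ∀ S w b, massAt (μS S w) f b = if w ∈ S then p / 2 else (1 - p) / 2 := fun S w b => by
    simp only [hμS]; split_ifs; exacts [hmass₁ b, hmass₂ b]
  have hPi : ∀ S : Finset (Fin d → Fin 3), ∏ w, ∑ a, μS S w a = p ^ S.card * (1 - p) ^ (3 ^ d - S.card) :=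
    fun S => by rw [Finset.prod_congr rfl fun w _ => hsumS S w, prod_ite_mem_eq_pow, hN]
  -- per-`S` bound
  have hper : ∀ S : Finset (Fin d → Fin 3),
      agreeAt (bw (μS S)) (fun X => recMaj3 d fun w => f (X w)) g ≤
        (1 / 2) * (p ^ S.card * (1 - p) ^ (3 ^ d - S.card)) +
        (1 / 2) * ((p / 2) ^ S.card * ((1 - p) / 2) ^ (3 ^ d - S.card) *
          ∑ v : (Fin d → Fin 3) → Bool, |cbias (recMaj3 d) S v|) +
        2 * γ * S.card * (p ^ S.card * (1 - p) ^ (3 ^ d - S.card)) := by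
    intro S
    -- A4 with `η = 2γ`: the one-block hypothesis from A0 + `hadv`
    have hyp : ∀ w ∈ S, ∀ X : (Fin d → Fin 3) → ι → Bool,
        (∑ a, if g (update X w a) = f a then μS S w a else 0) ≤ (1 / 2 + 2 * γ) * ∑ a, μS S w a := by
      intro w hw X
      have hμw : μS S w = μ₁ := by simp only [hμS, hw, if_true]
      rw [hμw, hm₁]
      obtain ⟨C, hC, hCs, hCe⟩ := blockRestriction_holds ι d M hM w X
      have hgC : ∀ a, g (update X w a) = C.eval a := fun a => by rw [hCe a]
      simp only [hgC]
      rw [sum_ite_agree_eq, hm₁]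
      have := hadv C hC hCs
      linarith
    have h4 := hybridStep (μS S) f (recMaj3_monotone d) g S (by positivity : (0 : ℝ) ≤ 2 * γ) (hμS0 S) hyp
    -- A5
    have h5 := finalHybridBound_holds (Fin d → Fin 3) (ι → Bool) (μS S) f (recMaj3 d) g S (hμS0 S)
    -- A6
    have h6 := pushforward_holds (Fin d → Fin 3) (ι → Bool) (μS S) f (fun v => |cbias (recMaj3 d) S v|)
    have h6' : ∑ v : (Fin d → Fin 3) → Bool, (∏ w, massAt (μS S w) f (v w)) * |cbias (recMaj3 d) S v| =
        (p / 2) ^ S.card * ((1 - p) / 2) ^ (3 ^ d - S.card) * ∑ v : (Fin d → Fin 3) → Bool, |cbias (recMaj3 d) S v| := by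
      rw [Finset.mul_sum]
      refine Finset.sum_congr rfl fun v _ => ?_
      rw [Finset.prod_congr rfl fun w _ => hmassS S w (v w), prod_ite_mem_eq_pow, hN]
    rw [hPi S] at h4 h5
    rw [h6, h6'] at h5
    linarith
  refine (Finset.sum_le_sum fun S _ => hper S).trans ?_
  rw [Finset.sum_add_distrib, Finset.sum_add_distrib, ← Finset.mul_sum, ← Finset.mul_sum]
  -- binomial resummations
  have hbin : ∑ S : Finset (Fin d → Fin 3), p ^ S.card * (1 - p) ^ (3 ^ d - S.card) = 1 := by
    rw [← hN, Fintype.sum_pow_mul_eq_add_pow]; ring_nf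
  have hE : ∑ S : Finset (Fin d → Fin 3), (p / 2) ^ S.card * ((1 - p) / 2) ^ (3 ^ d - S.card) *
      ∑ v : (Fin d → Fin 3) → Bool, |cbias (recMaj3 d) S v| = expAbsBias d p := by
    unfold expAbsBias
    refine Finset.sum_congr rfl fun S _ => ?_
    rw [Finset.mul_sum]
  have hlin : ∑ S : Finset (Fin d → Fin 3), 2 * γ * S.card * (p ^ S.card * (1 - p) ^ (3 ^ d - S.card)) ≤
      2 * γ * (3 : ℝ) ^ d := by
    calc ∑ S : Finset (Fin d → Fin 3), 2 * γ * S.card * (p ^ S.card * (1 - p) ^ (3 ^ d - S.card))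
        ≤ ∑ S : Finset (Fin d → Fin 3), 2 * γ * (3 : ℝ) ^ d * (p ^ S.card * (1 - p) ^ (3 ^ d - S.card)) := by
          refine Finset.sum_le_sum fun S _ => ?_
          have hS : (S.card : ℝ) ≤ (3 : ℝ) ^ d := by
            have := S.card_le_univ; rw [hN] at this; exact_mod_cast this
          have hw : 0 ≤ p ^ S.card * (1 - p) ^ (3 ^ d - S.card) :=
            mul_nonneg (pow_nonneg hp0 _) (pow_nonneg (by linarith) _)
          exact mul_le_mul_of_nonneg_right (mul_le_mul_of_nonneg_left hS (by positivity)) hw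
      _ = 2 * γ * (3 : ℝ) ^ d := by rw [← Finset.mul_sum, hbin, mul_one]
  rw [hbin, hE]
  linarith

end Summit.PneNP.PneNP.Theorems.NegLimitedAmplifiedWindow.Amp
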